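import Literature.AlgebraicGeometry.Motives.HodgeStructureCentralizerCenterFieldExtension
import HarnessLib

/-!
# THE SIMPLE FACTORS OF `C₀ ⊗ K` ALONG A FIELD EXTENSION `K → L`: EVERY FACTOR `F_i` OF `F ⊗_ℚ k = F₁ × ⋯ × F_t` HAS A FACTOR OF
# `F_i ⊗_k k'` ABOVE IT — `MaxSpec(Z(C(H)(L))) → MaxSpec(Z(C(H)(K)))` IS SURJECTIVE — AND THE PRIMITIVE CENTRAL IDEMPOTENTS `e_𝔪` AND
# THEIR BLOCKS `V_i = e_i V` BASE-CHANGE TO `Σ_{𝔫 | 𝔪} e_𝔫` AND `⊕_{𝔫 | 𝔪} V_𝔫` (Milne 1999 §1 Remark 1.6 «`C'(A) ≅ C(A) ⊗_k k'`»,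
# §2 p. 646 «`F ⊗_ℚ k = F₁ × ⋯ × F_t`, `1 = e₁ + ⋯ + e_t`, `V(A) = V₁ ⊕ ⋯ ⊕ V_t`, `V_i = e_i V`»)

[topic AlgebraicGeometry/Motives]

Layer `Literature/AlgebraicGeometry/Motives`, lane `lit-hodgefound` (Track 2 foundations library; prover seat
`lit-hodgefound-p02`, generation 56, self-proposed row g56-#3). THEOREMS ONLY: no definition, no named fact (net debt `0`),
no instance, no notation.  Refines g56-#1 (`Motives/HodgeStructureCentralizerCenterFieldExtension`: an injective ring homomorphism
`φ : Z_K = Z(C(H)(K)) → Z_L = Z(C(H)(L))` over `j : K ⊗ V → L ⊗ V`, and `t_K ≤ t_L` by counting idempotents).  Milne (§2, p. 646)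
decomposes the centre `F` of `End⁰(A)` after extension of scalars, `F ⊗_ℚ k = F₁ × ⋯ × F_t`, with orthogonal idempotents
`1 = e₁ + ⋯ + e_t` and blocks `V(A) = V₁ ⊕ ⋯ ⊕ V_t`, `V_i = e_i V`; Remark 1.6 (`C'(A) ≅ C(A) ⊗_k k'`) says how this behaves in
`k ⊆ k'`: each `F_i ⊗_k k'` splits further, `e_i ⊗ 1 = Σ_j e_{ij}`, `V_i ⊗_k k' = ⊕_j V_{ij}`.  PROVED here, for every polarizable
`ℚ`-Hodge structure `H` on a finite-dimensional `V`, all fields `ℚ ⊆ K ⊆ L` (any universes) and ANY ring homomorphism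
`φ : Z_K → Z_L` over `j` (such a `φ` exists by g56-#1 and is unique, being determined by `φ(z) ∘ j = j ∘ z`):
(i) ALGEBRA (reduced finite-dimensional commutative algebras `Z ≅ Π_𝔪 Z/𝔪`): for every maximal `𝔪` a UNIQUE idempotent `e_𝔪` with
`e_𝔪 ∉ 𝔪`, `e_𝔪 ∈ 𝔪'` (`𝔪' ≠ 𝔪`); idempotents are determined by the maximal ideals containing them; along an INJECTIVE ring
homomorphism `φ : Z → Z'` the contraction `𝔫 ↦ φ⁻¹(𝔫)` is a well-defined SURJECTION `MaxSpec(Z') → MaxSpec(Z)` whose fibre over `𝔪`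
is `{𝔫 | φ(e_𝔪) ∉ 𝔫}`;
(ii) BLOCKS ALONG `j`: the `L`-extension `F` of `f` has `F(L ⊗ V) = span_L j(f(K ⊗ V))`, and for an idempotent `e` also
`ker E = span_L j(ker e)` (`E` is again idempotent);
(iii) for `C(H)`: the primitive central idempotents `e_𝔪 ∈ Z_K` exist uniquely; **`MaxSpec(Z_L) → MaxSpec(Z_K)` is surjective**
(every simple factor of `C₀ ⊗ K` has a simple factor of `C₀ ⊗ L` above it — the honest form of `t_K ≤ t_L`); `𝔫` lies over `𝔪` iff
`φ(e_𝔪) ∉ 𝔫`; `φ(e_𝔪)` is THE idempotent of `Z_L` supported on the fibre (= `Σ_{𝔫 | 𝔪} e_𝔫`); and the block `e_𝔪(K ⊗ V)` spans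
`φ(e_𝔪)(L ⊗ V)` over `L`, its kernel likewise.

## The sources, verbatim

* J. S. Milne, *Lefschetz classes on abelian varieties*, Duke Math. J. 96 (1999) 639–675 [Milne1999LefschetzClasses] (held
  `paper:doi-10-1215-s0012-7094-99-09620-5`): folio 6 = p. 644 L30–L37 «**Remark 1.6.** … canonical isomorphisms
  `C'(A) ≅ C(A) ⊗_k k'`, `S'(A) ≅ S(A)_{/k'}`»; folio 7 = p. 645 L2–L6 «`C₀(A)` … is a product of fields»; folio 8 = p. 646 L33–L40
  «Let `F ⊗_ℚ k = F₁ × ⋯ × F_t` be the decomposition of `F ⊗_ℚ k` into a product of fields, and let `1 = e₁ + ⋯ + e_t` be the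
  corresponding decomposition of `1` into a sum of orthogonal idempotents. Then `V(A) = V₁ ⊕ ⋯ ⊕ V_t`, `V_i = e_i V = V ⊗_{F ⊗_ℚ k} F_i`.
  … Any `k`-linear map `α : V → V` commuting with the action of `F` decomposes into `α = α₁ ⊕ ⋯ ⊕ α_t`».
* R. S. Pierce, *Associative Algebras*, GTM 88 (1982) [Pierce1982], §10.7 Cor. b (commutative semisimple algebras are finite products
  of fields; idempotents = indicator vectors).
* M. F. Atiyah, I. G. Macdonald, *Introduction to Commutative Algebra* (1969) [AtiyahMacdonald1969], Ch. 8 Prop. 8.1 (primes of an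
  Artin ring are maximal), Prop. 8.4 (nilradical), Thm. 8.7 (structure theorem `A ≅ Π A_i`), Ch. 1 Prop. 1.8.
* N. Bourbaki, *Algebra I* [BourbakiAlgebraI1989], Ch. II §5 no. 1, no. 3 Prop. 7, §7 no. 7 (extension of scalars).

Nearest tree results, BY NAME: g56-#1 `exists_center_centralizer_ringHom_injective`, `natCard_maximalSpectrum_le_of_ringHom_injective`,
`exists_linearMap_extendScalars_comm` ∕ `linearMap_eq_of_extendScalars_comm` ∕ `mul_extendScalars_comm`, `span`-plumbing
`linearMap_ext_of_extendScalars`; g55-#8 `isReduced_center_centralizer_endAlg_baseChange`; `exists_orthogonal_idempotents_of_isReduced`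
(`Motives/HodgeStructureCMOddWeightCentreSkewUnit`: an abstract orthogonal idempotent system, not indexed by `MaxSpec` nor transported).

## Dictionary and what is proved

`j = extendScalars K L V`; "`F` extends `f`" = `∀ x, F (j x) = j (f x)`; `Z_K = Subalgebra.center K C(H)(K)`; "`φ` over `j`" =
`∀ z x, (φ z).1.1 (j x) = j (z.1.1 x)`; `e_𝔪` = the idempotent with `e ∉ 𝔪 ∧ ∀ 𝔪' ≠ 𝔪, e ∈ 𝔪'`.

* §1 algebra (namespace `…Motives.HodgeStructure`): **`existsUnique_isIdempotentElem_notMem_forall_mem`** (`e_𝔪`),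
  **`exists_maximalSpectrum_notMem_of_ne_zero`**, **`IsIdempotentElem.eq_of_forall_mem_iff`** (idempotents determined by their zero
  set), `isMaximal_comap_of_ringHom`, **`comap_maximalSpectrum_surjective`**, **`comap_eq_iff_map_notMem`** (fibre over `𝔪` =
  `{𝔫 | φ e_𝔪 ∉ 𝔫}`), `natCard_maximalSpectrum_le_of_ringHom_injective'`.
* §2 blocks (namespace `…Motives`): **`span_range_extendScalars_eq_top`**, **`range_eq_span_image_extendScalars_of_extendScalars_comm`**,
  `span_image_extendScalars_ker_le_of_extendScalars_comm`, **`IsIdempotentElem.of_extendScalars_comm`**,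
  **`ker_eq_span_image_extendScalars_of_isIdempotentElem`**.
* §3 for `C(H)` (namespace `…Motives.HodgeStructure`): `injective_of_ringHom_extendScalars_comm`,
  **`existsUnique_isIdempotentElem_center_centralizer_notMem`** (the `e_𝔪` of `C₀ ⊗ K`),
  **`comap_maximalSpectrum_center_centralizer_surjective`**, **`comap_eq_iff_map_isIdempotentElem_notMem`**,
  **`map_eq_of_isIdempotentElem_of_forall_mem_iff`** (`φ(e_𝔪)` = the idempotent supported on the fibre),
  **`range_map_eq_span_image_extendScalars`** (`φ(z)(L ⊗ V) = span_L j(z(K ⊗ V))`, kernels of idempotents likewise).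
-/

noncomputable section

open scoped TensorProduct

namespace Literature.AlgebraicGeometry.Motives

universe u u' v

namespace HodgeStructure

/-! ## §1 Algebra: primitive idempotents of a reduced finite-dimensional commutative algebra, and the contraction of maximal
ideals along an injective ring homomorphism -/

section Algebra

/-- `z ∈ 𝔪 ⟺` the `𝔪`-component of `z` in `Z ≅ Π_𝔪 Z/𝔪` vanishes. [folklore] -/
private theorem equivPi_apply_eq_zero_iff₅₆₃ {Z : Type*} [CommRing Z] [IsArtinianRing Z] [IsReduced Z] (z : Z) (I : MaximalSpectrum Z) :
    IsArtinianRing.equivPi Z z I = 0 ↔ z ∈ I.asIdeal := by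
  rw [IsArtinianRing.equivPi_apply]
  exact Ideal.Quotient.eq_zero_iff_mem

/-- **THE PRIMITIVE IDEMPOTENT `e_𝔪` OF A MAXIMAL IDEAL**: in a reduced finite-dimensional commutative `K`-algebra `Z ≅ Π_𝔪 Z/𝔪` there
is, for every maximal ideal `𝔪`, a unique idempotent `e` with `e ∉ 𝔪` and `e ∈ 𝔪'` for every other maximal ideal `𝔪'` (the
indicator vector of `{𝔪}`; Milne's `1 = e₁ + ⋯ + e_t`). [cite: Pierce1982, §10.7 Cor. b] [cite: AtiyahMacdonald1969, Ch. 8 Thm. 8.7] -/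
theorem existsUnique_isIdempotentElem_notMem_forall_mem (K : Type u) [Field K] (Z : Type*) [CommRing Z] [Algebra K Z]
    [Module.Finite K Z] [IsReduced Z] (I : MaximalSpectrum Z) :
    ∃! e : Z, IsIdempotentElem e ∧ e ∉ I.asIdeal ∧ ∀ J : MaximalSpectrum Z, J ≠ I → e ∈ J.asIdeal := by
  classical
  haveI : IsArtinianRing Z := IsArtinianRing.of_finite K Z
  let ζ := IsArtinianRing.equivPi Z
  refine ⟨ζ.symm (Pi.single I 1), ⟨?_, ?_, fun J hJ => ?_⟩, fun e ⟨he, heI, heJ⟩ => ?_⟩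
  · rw [IsIdempotentElem, ← map_mul, ← Pi.single_mul, mul_one]
  · rw [← equivPi_apply_eq_zero_iff₅₆₃, AlgEquiv.apply_symm_apply, Pi.single_eq_same]
    exact one_ne_zero
  · rw [← equivPi_apply_eq_zero_iff₅₆₃, AlgEquiv.apply_symm_apply, Pi.single_eq_of_ne hJ]
  · apply ζ.injective
    rw [AlgEquiv.apply_symm_apply]
    funext J
    by_cases hJ : J = I
    · subst hJ
      rw [Pi.single_eq_same]
      -- `ζ e J` is an idempotent `≠ 0` of the field `Z/J`, hence `1`
      have hid : IsIdempotentElem (ζ e J) := by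
        rw [IsIdempotentElem, ← Pi.mul_apply, ← map_mul, he.eq]
      have hne : ζ e J ≠ 0 := fun h => heI ((equivPi_apply_eq_zero_iff₅₆₃ e J).1 h)
      exact (IsIdempotentElem.iff_eq_zero_or_one.1 hid).resolve_left hne
    · rw [Pi.single_eq_of_ne hJ]
      exact (equivPi_apply_eq_zero_iff₅₆₃ e J).2 (heJ J hJ)

/-- A non-zero element of a reduced finite-dimensional commutative algebra lies outside some maximal ideal (`⋂ 𝔪 = 0`). [cite: AtiyahMacdonald1969, Ch. 8 Prop. 8.4 and Ch. 1 Prop. 1.8] -/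
theorem exists_maximalSpectrum_notMem_of_ne_zero (K : Type u) [Field K] (Z : Type*) [CommRing Z] [Algebra K Z] [Module.Finite K Z]
    [IsReduced Z] {z : Z} (hz : z ≠ 0) : ∃ I : MaximalSpectrum Z, z ∉ I.asIdeal := by
  haveI : IsArtinianRing Z := IsArtinianRing.of_finite K Z
  by_contra h
  push Not at h
  apply hz
  apply (IsArtinianRing.equivPi Z).injective
  rw [map_zero]
  funext I
  exact (equivPi_apply_eq_zero_iff₅₆₃ z I).2 (h I)

/-- **AN IDEMPOTENT OF A REDUCED FINITE-DIMENSIONAL COMMUTATIVE ALGEBRA IS DETERMINED BY THE MAXIMAL IDEALS CONTAINING IT** (its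
zero set in `MaxSpec`: the idempotents are the indicator vectors `e_J`). [cite: Pierce1982, §10.7 Cor. b] -/
theorem IsIdempotentElem.eq_of_forall_mem_iff (K : Type u) [Field K] (Z : Type*) [CommRing Z] [Algebra K Z] [Module.Finite K Z]
    [IsReduced Z] {u u' : Z} (hu : IsIdempotentElem u) (hu' : IsIdempotentElem u')
    (h : ∀ I : MaximalSpectrum Z, u ∈ I.asIdeal ↔ u' ∈ I.asIdeal) : u = u' := by
  haveI : IsArtinianRing Z := IsArtinianRing.of_finite K Z
  apply (IsArtinianRing.equivPi Z).injective
  funext I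
  have h01 : ∀ {w : Z}, IsIdempotentElem w → IsArtinianRing.equivPi Z w I = 0 ∨ IsArtinianRing.equivPi Z w I = 1 :=
    fun {w} hw => IsIdempotentElem.iff_eq_zero_or_one.1 (by
      rw [IsIdempotentElem, ← Pi.mul_apply, ← map_mul, hw.eq])
  rcases h01 hu with h0 | h1 <;> rcases h01 hu' with h0' | h1'
  · rw [h0, h0']
  · exact absurd ((h I).1 ((equivPi_apply_eq_zero_iff₅₆₃ u I).1 h0)) (fun hm =>
      one_ne_zero (h1'.symm.trans ((equivPi_apply_eq_zero_iff₅₆₃ u' I).2 hm)))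
  · exact absurd ((h I).2 ((equivPi_apply_eq_zero_iff₅₆₃ u' I).1 h0')) (fun hm =>
      one_ne_zero (h1.symm.trans ((equivPi_apply_eq_zero_iff₅₆₃ u I).2 hm)))
  · rw [h1, h1']

/-- The contraction of a maximal ideal of `Z'` along a ring homomorphism `Z → Z'` is maximal (`Z` is Artinian: primes are maximal).
[cite: AtiyahMacdonald1969, Ch. 8 Prop. 8.1] -/
theorem isMaximal_comap_of_ringHom (K : Type u) [Field K] (Z : Type*) [CommRing Z] [Algebra K Z] [Module.Finite K Z] {Z' : Type*}
    [CommRing Z'] (φ : Z →+* Z') (I' : MaximalSpectrum Z') : (I'.asIdeal.comap φ).IsMaximal := by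
  haveI : IsArtinianRing Z := IsArtinianRing.of_finite K Z
  haveI : (I'.asIdeal.comap φ).IsPrime := Ideal.comap_isPrime φ I'.asIdeal
  exact IsArtinianRing.isMaximal_of_isPrime _

/-- **ALONG AN INJECTIVE RING HOMOMORPHISM `φ : Z → Z'` OF REDUCED FINITE-DIMENSIONAL COMMUTATIVE ALGEBRAS EVERY SIMPLE FACTOR OF `Z`
HAS A SIMPLE FACTOR OF `Z'` ABOVE IT**: `𝔫 ↦ φ⁻¹(𝔫)`, `MaxSpec(Z') → MaxSpec(Z)`, is surjective — the primitive idempotent `e_𝔪` has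
`φ(e_𝔪) ≠ 0`, so `φ(e_𝔪) ∉ 𝔫` for some `𝔫`, and then `φ⁻¹(𝔫) = 𝔪`. [cite: Pierce1982, §10.7 Cor. b] [cite: AtiyahMacdonald1969, Ch. 8 Thm. 8.7] -/
theorem comap_maximalSpectrum_surjective (K : Type u) [Field K] (Z : Type*) [CommRing Z] [Algebra K Z] [Module.Finite K Z]
    [IsReduced Z] (K' : Type u') [Field K'] (Z' : Type*) [CommRing Z'] [Algebra K' Z'] [Module.Finite K' Z'] [IsReduced Z']
    (φ : Z →+* Z') (hφ : Function.Injective φ) :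
    Function.Surjective fun I' : MaximalSpectrum Z' =>
      (⟨I'.asIdeal.comap φ, isMaximal_comap_of_ringHom K Z φ I'⟩ : MaximalSpectrum Z) := by
  intro I
  obtain ⟨e, ⟨he, heI, heJ⟩, -⟩ := existsUnique_isIdempotentElem_notMem_forall_mem K Z I
  have hφe : φ e ≠ 0 := fun h => heI (by rw [(injective_iff_map_eq_zero φ).1 hφ e h]; exact I.asIdeal.zero_mem)
  obtain ⟨I', hI'⟩ := exists_maximalSpectrum_notMem_of_ne_zero K' Z' hφe
  refine ⟨I', ?_⟩
  by_contra hne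
  exact hI' (Ideal.mem_comap.1 (heJ _ hne))

/-- **THE FIBRE OF `MaxSpec(Z') → MaxSpec(Z)` OVER `𝔪` IS CUT OUT BY THE PRIMITIVE IDEMPOTENT `e_𝔪`**: `φ⁻¹(𝔫) = 𝔪 ⟺ φ(e_𝔪) ∉ 𝔫`
(`φ(e_𝔪) = Σ_{𝔫 above 𝔪} e_𝔫`). [cite: Pierce1982, §10.7 Cor. b] -/
theorem comap_eq_iff_map_notMem (K : Type u) [Field K] (Z : Type*) [CommRing Z] [Algebra K Z] [Module.Finite K Z] {Z' : Type*}
    [CommRing Z'] (φ : Z →+* Z') (I : MaximalSpectrum Z) (I' : MaximalSpectrum Z') {e : Z}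
    (heI : e ∉ I.asIdeal) (heJ : ∀ J : MaximalSpectrum Z, J ≠ I → e ∈ J.asIdeal) :
    (⟨I'.asIdeal.comap φ, isMaximal_comap_of_ringHom K Z φ I'⟩ : MaximalSpectrum Z) = I ↔ φ e ∉ I'.asIdeal := by
  constructor
  · rintro h hmem
    have : e ∈ (I'.asIdeal.comap φ) := Ideal.mem_comap.2 hmem
    rw [show I'.asIdeal.comap φ = I.asIdeal from congrArg MaximalSpectrum.asIdeal h] at this
    exact heI this
  · intro h
    by_contra hne
    exact h (Ideal.mem_comap.1 (heJ _ hne))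

/-- `#MaxSpec(Z) ≤ #MaxSpec(Z')` once more, now from the surjection (g56-#1 derived it from the injection on idempotents).
[cite: Pierce1982, §10.7 Cor. b] -/
theorem natCard_maximalSpectrum_le_of_ringHom_injective' (K : Type u) [Field K] (Z : Type*) [CommRing Z] [Algebra K Z]
    [Module.Finite K Z] [IsReduced Z] (K' : Type u') [Field K'] (Z' : Type*) [CommRing Z'] [Algebra K' Z'] [Module.Finite K' Z']
    [IsReduced Z'] (φ : Z →+* Z') (hφ : Function.Injective φ) :
    Nat.card (MaximalSpectrum Z) ≤ Nat.card (MaximalSpectrum Z') := by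
  haveI : IsArtinianRing Z' := IsArtinianRing.of_finite K' Z'
  exact Nat.card_le_card_of_surjective _ (comap_maximalSpectrum_surjective K Z K' Z' φ hφ)

end Algebra

end HodgeStructure

/-! ## §2 Ranges and kernels of idempotents along `j`: the block `e(K ⊗ V)` spans `E(L ⊗ V)` over `L` -/

section Blocks

variable (K : Type u) (L : Type u') [Field K] [Field L] [Algebra ℚ K] [Algebra ℚ L] [Algebra K L]
  [IsScalarTower ℚ K L] (V : Type v) [AddCommGroup V] [Module ℚ V]

/-- **`L ⊗_ℚ V` IS SPANNED OVER `L` BY `j(K ⊗ V)`.** [cite: BourbakiAlgebraI1989, Ch. II §7 no. 7] -/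
theorem span_range_extendScalars_eq_top : Submodule.span L (Set.range (extendScalars K L V)) = ⊤ := by
  refine Submodule.eq_top_iff'.2 fun y => ?_
  induction y using TensorProduct.induction_on with
  | zero => exact Submodule.zero_mem _
  | tmul l v =>
    rw [show (l ⊗ₜ[ℚ] v : L ⊗[ℚ] V) = l • extendScalars K L V ((1 : K) ⊗ₜ[ℚ] v) by
      rw [extendScalars_one_tmul, TensorProduct.smul_tmul', smul_eq_mul, mul_one]]
    exact Submodule.smul_mem _ _ (Submodule.subset_span ⟨_, rfl⟩)
  | add x y hx hy => exact Submodule.add_mem _ hx hy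

/-- **THE RANGE OF THE `L`-EXTENSION `F` OF `f` IS THE `L`-SPAN OF `j(range f)`**: `F(L ⊗ V) = span_L j(f(K ⊗ V))` («`V_i ⊗ k'`»
for the block `V_i = e_i V`). [cite: BourbakiAlgebraI1989, Ch. II §7 no. 7 and §5 no. 1] [cite: Milne1999LefschetzClasses, §2 p. 646 L33–L38] -/
theorem range_eq_span_image_extendScalars_of_extendScalars_comm {f : Module.End K (K ⊗[ℚ] V)} {F : Module.End L (L ⊗[ℚ] V)}
    (hF : ∀ x, F (extendScalars K L V x) = extendScalars K L V (f x)) :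
    LinearMap.range F = Submodule.span L (extendScalars K L V '' (LinearMap.range f : Set (K ⊗[ℚ] V))) := by
  rw [LinearMap.range_eq_map, ← span_range_extendScalars_eq_top K L V, Submodule.map_span, ← Set.range_comp]
  congr 1
  ext y
  constructor
  · rintro ⟨x, rfl⟩
    exact ⟨f x, LinearMap.mem_range_self f x, (hF x).symm⟩
  · rintro ⟨_, ⟨x, rfl⟩, rfl⟩
    exact ⟨x, hF x⟩

/-- `j(ker f) ⊆ ker F`, hence `span_L j(ker f) ≤ ker F`. [cite: BourbakiAlgebraI1989, Ch. II §5 no. 1] -/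
theorem span_image_extendScalars_ker_le_of_extendScalars_comm {f : Module.End K (K ⊗[ℚ] V)} {F : Module.End L (L ⊗[ℚ] V)}
    (hF : ∀ x, F (extendScalars K L V x) = extendScalars K L V (f x)) :
    Submodule.span L (extendScalars K L V '' (LinearMap.ker f : Set (K ⊗[ℚ] V))) ≤ LinearMap.ker F := by
  refine Submodule.span_le.2 ?_
  rintro _ ⟨x, hx, rfl⟩
  rw [SetLike.mem_coe, LinearMap.mem_ker, hF, LinearMap.mem_ker.1 hx, map_zero]

/-- **The `L`-extension of an idempotent is an idempotent** (`E²` and `E` both extend `e² = e`). [cite: BourbakiAlgebraI1989, Ch. II §5 no. 1] -/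
theorem IsIdempotentElem.of_extendScalars_comm {e : Module.End K (K ⊗[ℚ] V)} {E : Module.End L (L ⊗[ℚ] V)}
    (hE : ∀ x, E (extendScalars K L V x) = extendScalars K L V (e x)) (he : IsIdempotentElem e) : IsIdempotentElem E :=
  linearMap_eq_of_extendScalars_comm K L V (mul_extendScalars_comm K L V hE hE) fun x => by rw [he.eq, hE]

/-- **THE KERNEL OF THE EXTENSION OF AN IDEMPOTENT `e` IS THE `L`-SPAN OF `j(ker e)`** (`ker E = (1 − E)(L ⊗ V)` and `1 − E` extends
`1 − e`): both blocks `e(K ⊗ V)` and `(1 − e)(K ⊗ V)` base-change to the blocks of `E`. [cite: BourbakiAlgebraI1989, Ch. II §7 no. 7 and §5 no. 1]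
[cite: Milne1999LefschetzClasses, §2 p. 646 L33–L38] -/
theorem ker_eq_span_image_extendScalars_of_isIdempotentElem {e : Module.End K (K ⊗[ℚ] V)} {E : Module.End L (L ⊗[ℚ] V)}
    (hE : ∀ x, E (extendScalars K L V x) = extendScalars K L V (e x)) (he : IsIdempotentElem e) :
    LinearMap.ker E = Submodule.span L (extendScalars K L V '' (LinearMap.ker e : Set (K ⊗[ℚ] V))) := by
  have hE' := IsIdempotentElem.of_extendScalars_comm K L V hE he
  have h1 : ∀ x, (1 - E) (extendScalars K L V x) = extendScalars K L V ((1 - e) x) := fun x => by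
    rw [LinearMap.sub_apply, LinearMap.sub_apply, Module.End.one_apply, Module.End.one_apply, map_sub, hE]
  rw [LinearMap.IsIdempotentElem.ker_eq_range_one_sub hE', LinearMap.IsIdempotentElem.ker_eq_range_one_sub he]
  exact range_eq_span_image_extendScalars_of_extendScalars_comm K L V h1

end Blocks

namespace HodgeStructure

/-! ## §3 The factors of `C₀ ⊗ K` along `K → L`: `MaxSpec(Z_L) → MaxSpec(Z_K)` is surjective, fibres cut out by the `e_𝔪` -/

section Factors

variable (K : Type u) (L : Type u') [Field K] [Field L] [Algebra ℚ K] [Algebra ℚ L] [Algebra K L]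
  [IsScalarTower ℚ K L] {V : Type v} [AddCommGroup V] [Module ℚ V] [Module.Finite ℚ V] {n : ℤ} (H : HodgeStructure V n)

set_option maxSynthPendingDepth 4 in
/-- The standing instance on `Z_K`: finite-dimensional over `K`. [folklore] -/
private theorem finite_center_centralizer₅₆₃ :
    Module.Finite K (Subalgebra.center K (Subalgebra.centralizer K
      ((fun a : Module.End ℚ V => a.baseChange K) '' (H.endAlg : Set (Module.End ℚ V))))) := by
  haveI := finite_centralizer_endAlg_baseChange K H
  haveI : IsNoetherian K (Subalgebra.centralizer K
      ((fun a : Module.End ℚ V => a.baseChange K) '' (H.endAlg : Set (Module.End ℚ V)))) :=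
    isNoetherian_of_isNoetherianRing_of_finite K _
  exact Module.Finite.of_injective (Subalgebra.val _).toLinearMap Subtype.val_injective

set_option maxSynthPendingDepth 4 in
omit [Module.Finite ℚ V] in
/-- A ring homomorphism `Z_K → Z_L` over `j` is injective (one `L`-endomorphism extends at most one `K`-endomorphism). [cite: BourbakiAlgebraI1989, Ch. II §5 no. 3 Prop. 7] -/
theorem injective_of_ringHom_extendScalars_comm
    (φ : Subalgebra.center K (Subalgebra.centralizer K
        ((fun a : Module.End ℚ V => a.baseChange K) '' (H.endAlg : Set (Module.End ℚ V)))) →+*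
      Subalgebra.center L (Subalgebra.centralizer L
        ((fun a : Module.End ℚ V => a.baseChange L) '' (H.endAlg : Set (Module.End ℚ V)))))
    (hφ : ∀ z x, ((φ z).1.1 : Module.End L (L ⊗[ℚ] V)) (extendScalars K L V x) =
      extendScalars K L V ((z.1.1 : Module.End K (K ⊗[ℚ] V)) x)) :
    Function.Injective φ := fun z z' h =>
  Subtype.ext (Subtype.ext (eq_of_extendScalars_comm_of_extendScalars_comm K L V (hφ z) (fun x => by
    rw [← hφ z' x, h])))

set_option maxSynthPendingDepth 4 in
/-- **THE PRIMITIVE CENTRAL IDEMPOTENTS `e_𝔪` OF `C(H)(K)`** (polarizable `H`): for every maximal ideal `𝔪` of `Z_K = C₀ ⊗ K` there is a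
unique idempotent `e_𝔪 ∈ Z_K` outside `𝔪` and inside every other maximal ideal — Milne's «`1 = e₁ + ⋯ + e_t`» for
`F ⊗_ℚ k = F₁ × ⋯ × F_t`, on `K`-points. [cite: Milne1999LefschetzClasses, §2 p. 646 L33–L38 and §1 p. 645 L2–L6] [cite: Pierce1982, §10.7 Cor. b] -/
theorem existsUnique_isIdempotentElem_center_centralizer_notMem (hH : H.IsPolarizable)
    (I : MaximalSpectrum (Subalgebra.center K (Subalgebra.centralizer K
        ((fun a : Module.End ℚ V => a.baseChange K) '' (H.endAlg : Set (Module.End ℚ V)))))) :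
    ∃! e : Subalgebra.center K (Subalgebra.centralizer K
        ((fun a : Module.End ℚ V => a.baseChange K) '' (H.endAlg : Set (Module.End ℚ V)))),
      IsIdempotentElem e ∧ e ∉ I.asIdeal ∧ ∀ J : MaximalSpectrum (Subalgebra.center K (Subalgebra.centralizer K
        ((fun a : Module.End ℚ V => a.baseChange K) '' (H.endAlg : Set (Module.End ℚ V))))), J ≠ I → e ∈ J.asIdeal := by
  haveI := finite_center_centralizer₅₆₃ K H
  haveI := isReduced_center_centralizer_endAlg_baseChange K hH
  exact existsUnique_isIdempotentElem_notMem_forall_mem K _ I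

set_option maxSynthPendingDepth 4 in
/-- **EVERY SIMPLE FACTOR OF `C₀ ⊗ K` HAS A SIMPLE FACTOR OF `C₀ ⊗ L` ABOVE IT**: along any ring homomorphism `φ : Z_K → Z_L` over `j`
(g56-#1 `exists_center_centralizer_ringHom_injective`), the contraction `𝔫 ↦ φ⁻¹(𝔫)`, `MaxSpec(Z_L) → MaxSpec(Z_K)`, is well defined and
SURJECTIVE — each factor `F_i` of `F ⊗_ℚ k` splits into the (`≥ 1`) factors of `F_i ⊗_k k'` (the precise form of `t_K ≤ t_L`).
[cite: Milne1999LefschetzClasses, §1 Remark 1.6 (p. 644) and §2 p. 646 L33–L38] [cite: Pierce1982, §10.7 Cor. b] -/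
theorem comap_maximalSpectrum_center_centralizer_surjective (hH : H.IsPolarizable)
    (φ : Subalgebra.center K (Subalgebra.centralizer K
        ((fun a : Module.End ℚ V => a.baseChange K) '' (H.endAlg : Set (Module.End ℚ V)))) →+*
      Subalgebra.center L (Subalgebra.centralizer L
        ((fun a : Module.End ℚ V => a.baseChange L) '' (H.endAlg : Set (Module.End ℚ V)))))
    (hφ : ∀ z x, ((φ z).1.1 : Module.End L (L ⊗[ℚ] V)) (extendScalars K L V x) =
      extendScalars K L V ((z.1.1 : Module.End K (K ⊗[ℚ] V)) x)) :
    ∃ hmax : ∀ I' : MaximalSpectrum (Subalgebra.center L (Subalgebra.centralizer L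
        ((fun a : Module.End ℚ V => a.baseChange L) '' (H.endAlg : Set (Module.End ℚ V))))), (I'.asIdeal.comap φ).IsMaximal,
      Function.Surjective fun I' : MaximalSpectrum (Subalgebra.center L (Subalgebra.centralizer L
          ((fun a : Module.End ℚ V => a.baseChange L) '' (H.endAlg : Set (Module.End ℚ V))))) =>
        (⟨I'.asIdeal.comap φ, hmax I'⟩ : MaximalSpectrum (Subalgebra.center K (Subalgebra.centralizer K
          ((fun a : Module.End ℚ V => a.baseChange K) '' (H.endAlg : Set (Module.End ℚ V)))))) := by
  haveI := finite_center_centralizer₅₆₃ K H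
  haveI := finite_center_centralizer₅₆₃ L H
  haveI := isReduced_center_centralizer_endAlg_baseChange K hH
  haveI := isReduced_center_centralizer_endAlg_baseChange L hH
  exact ⟨isMaximal_comap_of_ringHom K _ φ,
    comap_maximalSpectrum_surjective K _ L _ φ (injective_of_ringHom_extendScalars_comm K L H φ hφ)⟩

set_option maxSynthPendingDepth 4 in
omit [Algebra K L] [IsScalarTower ℚ K L] in
/-- **THE FIBRE OVER `𝔪` IS CUT OUT BY `φ(e_𝔪)`**: for the primitive central idempotent `e_𝔪` of `C(H)(K)`, a maximal ideal `𝔫` of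
`Z_L` lies over `𝔪` iff `φ(e_𝔪) ∉ 𝔫` — `φ(e_𝔪) = Σ_{𝔫 above 𝔪} e_𝔫`, i.e. `e_i ⊗ 1 = Σ_j e_{ij}` for `F_i ⊗_k k' = Π_j F_{ij}`.
[cite: Milne1999LefschetzClasses, §1 Remark 1.6 (p. 644) and §2 p. 646 L33–L38] [cite: Pierce1982, §10.7 Cor. b] -/
theorem comap_eq_iff_map_isIdempotentElem_notMem
    (φ : Subalgebra.center K (Subalgebra.centralizer K
        ((fun a : Module.End ℚ V => a.baseChange K) '' (H.endAlg : Set (Module.End ℚ V)))) →+*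
      Subalgebra.center L (Subalgebra.centralizer L
        ((fun a : Module.End ℚ V => a.baseChange L) '' (H.endAlg : Set (Module.End ℚ V)))))
    (I : MaximalSpectrum (Subalgebra.center K (Subalgebra.centralizer K
        ((fun a : Module.End ℚ V => a.baseChange K) '' (H.endAlg : Set (Module.End ℚ V))))))
    (I' : MaximalSpectrum (Subalgebra.center L (Subalgebra.centralizer L
        ((fun a : Module.End ℚ V => a.baseChange L) '' (H.endAlg : Set (Module.End ℚ V))))))
    {e : Subalgebra.center K (Subalgebra.centralizer K
        ((fun a : Module.End ℚ V => a.baseChange K) '' (H.endAlg : Set (Module.End ℚ V))))}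
    (heI : e ∉ I.asIdeal) (heJ : ∀ J : MaximalSpectrum (Subalgebra.center K (Subalgebra.centralizer K
        ((fun a : Module.End ℚ V => a.baseChange K) '' (H.endAlg : Set (Module.End ℚ V))))), J ≠ I → e ∈ J.asIdeal) :
    I'.asIdeal.comap φ = I.asIdeal ↔ φ e ∉ I'.asIdeal := by
  haveI := finite_center_centralizer₅₆₃ K H
  have h := comap_eq_iff_map_notMem K _ φ I I' heI heJ
  rw [← h]
  constructor
  · intro h'
    exact MaximalSpectrum.ext h'
  · intro h'
    exact congrArg MaximalSpectrum.asIdeal h'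

set_option maxSynthPendingDepth 4 in
omit [Algebra K L] [IsScalarTower ℚ K L] in
/-- **`φ(e_𝔪)` IS THE UNIQUE IDEMPOTENT OF `Z_L` WHOSE ZERO SET IN `MaxSpec(Z_L)` IS THE COMPLEMENT OF THE FIBRE OVER `𝔪`** (polarizable
`H`) — so `φ(e_𝔪) = Σ_{𝔫 above 𝔪} e_𝔫` for the primitive idempotents `e_𝔫` of `Z_L`: the block `e_𝔪(K ⊗ V) = V_i` base-changes to
`⊕_{𝔫 above 𝔪} e_𝔫(L ⊗ V)`. [cite: Milne1999LefschetzClasses, §1 Remark 1.6 (p. 644) and §2 p. 646 L33–L38] [cite: Pierce1982, §10.7 Cor. b] -/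
theorem map_eq_of_isIdempotentElem_of_forall_mem_iff (hH : H.IsPolarizable)
    (φ : Subalgebra.center K (Subalgebra.centralizer K
        ((fun a : Module.End ℚ V => a.baseChange K) '' (H.endAlg : Set (Module.End ℚ V)))) →+*
      Subalgebra.center L (Subalgebra.centralizer L
        ((fun a : Module.End ℚ V => a.baseChange L) '' (H.endAlg : Set (Module.End ℚ V)))))
    (I : MaximalSpectrum (Subalgebra.center K (Subalgebra.centralizer K
        ((fun a : Module.End ℚ V => a.baseChange K) '' (H.endAlg : Set (Module.End ℚ V))))))
    {e : Subalgebra.center K (Subalgebra.centralizer K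
        ((fun a : Module.End ℚ V => a.baseChange K) '' (H.endAlg : Set (Module.End ℚ V))))}
    (he : IsIdempotentElem e) (heI : e ∉ I.asIdeal)
    (heJ : ∀ J : MaximalSpectrum (Subalgebra.center K (Subalgebra.centralizer K
        ((fun a : Module.End ℚ V => a.baseChange K) '' (H.endAlg : Set (Module.End ℚ V))))), J ≠ I → e ∈ J.asIdeal)
    {u : Subalgebra.center L (Subalgebra.centralizer L
        ((fun a : Module.End ℚ V => a.baseChange L) '' (H.endAlg : Set (Module.End ℚ V))))}
    (hu : IsIdempotentElem u)
    (hsupp : ∀ I' : MaximalSpectrum (Subalgebra.center L (Subalgebra.centralizer L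
        ((fun a : Module.End ℚ V => a.baseChange L) '' (H.endAlg : Set (Module.End ℚ V))))),
      u ∉ I'.asIdeal ↔ I'.asIdeal.comap φ = I.asIdeal) :
    φ e = u := by
  haveI := finite_center_centralizer₅₆₃ L H
  haveI := isReduced_center_centralizer_endAlg_baseChange L hH
  refine IsIdempotentElem.eq_of_forall_mem_iff L _ (he.map φ) hu fun I' => ?_
  rw [← not_iff_not, ← comap_eq_iff_map_isIdempotentElem_notMem K L H φ I I' heI heJ, hsupp I']

set_option maxSynthPendingDepth 4 in
omit [Module.Finite ℚ V] in
/-- **THE BLOCK `z(K ⊗ V)` OF A CENTRAL `z` SPANS THE BLOCK `φ(z)(L ⊗ V)` OVER `L`**, and for a central IDEMPOTENT `e` also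
`ker φ(e) = span_L j(ker e)`: Milne's `V_i = e_i V` along `k ⊆ k'` — `V_i ⊗_k k' = (e_i ⊗ 1)(V ⊗ k') = ⊕_j V_{ij}`.
[cite: Milne1999LefschetzClasses, §1 Remark 1.6 (p. 644) and §2 p. 646 L33–L38] [cite: BourbakiAlgebraI1989, Ch. II §7 no. 7] -/
theorem range_map_eq_span_image_extendScalars
    (φ : Subalgebra.center K (Subalgebra.centralizer K
        ((fun a : Module.End ℚ V => a.baseChange K) '' (H.endAlg : Set (Module.End ℚ V)))) →+*
      Subalgebra.center L (Subalgebra.centralizer L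
        ((fun a : Module.End ℚ V => a.baseChange L) '' (H.endAlg : Set (Module.End ℚ V)))))
    (hφ : ∀ z x, ((φ z).1.1 : Module.End L (L ⊗[ℚ] V)) (extendScalars K L V x) =
      extendScalars K L V ((z.1.1 : Module.End K (K ⊗[ℚ] V)) x))
    (z : Subalgebra.center K (Subalgebra.centralizer K
        ((fun a : Module.End ℚ V => a.baseChange K) '' (H.endAlg : Set (Module.End ℚ V))))) :
    LinearMap.range ((φ z).1.1 : Module.End L (L ⊗[ℚ] V)) =
        Submodule.span L (extendScalars K L V '' (LinearMap.range (z.1.1 : Module.End K (K ⊗[ℚ] V)) : Set (K ⊗[ℚ] V))) ∧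
      (IsIdempotentElem z → LinearMap.ker ((φ z).1.1 : Module.End L (L ⊗[ℚ] V)) =
        Submodule.span L (extendScalars K L V '' (LinearMap.ker (z.1.1 : Module.End K (K ⊗[ℚ] V)) : Set (K ⊗[ℚ] V)))) := by
  refine ⟨range_eq_span_image_extendScalars_of_extendScalars_comm K L V (hφ z), fun hz => ?_⟩
  have hz' : IsIdempotentElem (z.1.1 : Module.End K (K ⊗[ℚ] V)) := by
    have h := congrArg (fun w : Subalgebra.center K (Subalgebra.centralizer K
      ((fun a : Module.End ℚ V => a.baseChange K) '' (H.endAlg : Set (Module.End ℚ V)))) => (w.1.1 : Module.End K (K ⊗[ℚ] V))) hz.eq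
    exact h
  exact ker_eq_span_image_extendScalars_of_isIdempotentElem K L V (hφ z) hz'

end Factors

end HodgeStructure

end Literature.AlgebraicGeometry.Motives
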